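import Mathlib
import HarnessLib
import Summits.HubbardSuperconductivity.HubbardSuperconductivity.Theorems.KLProgrammePolarRayCoareaJacobian
import Summits.HubbardSuperconductivity.HubbardSuperconductivity.Theorems.KLProgrammeH10TwoPointLimitFramePerturbation

/-!
# Route `KLProgramme` — crux K3, ENGINE child (gen 4 `KLRegimeEngineV12` stmt-HubbardSuperconductivity-19855): the RADIAL LIPSCHITZ input `κ₂` of
# the level-set Jacobian's e-Lipschitz constant, DISCHARGED from `FrameOK` (cell gate-hubbard-kl, seat hubbard-kl-k3c2-p2, g3)

`…PolarRayCoareaJacobian` (`klrj_jacobian_lipschitz`) bounds the e-Lipschitz constant of the frame-curve Jacobian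
`𝒥_E(θ,e) = u_E(μ+e,θ)·(∂_tε₀ + Dδ[dir θ])⁻¹` — the `L_W` input of the zero-sound / thermal estimate `klte_slice_bubble_weighted_norm_le` —
by `(1/d² + π√2(2+κ₂)/d³)`, GIVEN a radial Lipschitz constant `κ₂` of `t ↦ Dδ(t·dir θ)[dir θ]` (ZS-RECIPE §0: «κ₂ from FrameOK's j = 2 bound by p4's
sup conversion»).  This file supplies that input:
* §1 `klrk_radial_fderiv_lipschitz` — for `δ ∈ C²` with `‖D(Dδ)‖ ≤ κ₂` everywhere and `‖v‖ ≤ 1`: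
  `|Dδ(s·v)[v] − Dδ(t·v)[v]| ≤ κ₂|s − t|` (mean value along the ray; `(Dδ(r·v)[v])′ = D²δ(r·v)[v,v]`);
* §2 the FRAME instance `δ_K = frameShift K ∘ toLp` under `FrameOK R U (nScales β) μ K` in the KL regime `klBetaMin ≤ β ≤ e^{c/U²}`:
  with `A := 2·Gfr 0·|U| + 2·Gfr 1·U² + Gfr 2·c/log 4` (p4's `norm_iteratedFDeriv_frameShift_le_of_frameOK_regime`) all three p4 hypotheses hold with
  `κ := 4A` (`frameShift_toLp_small`) AND the radial one with `κ₂ := 4A` (`klrk_frameShift_radial_lipschitz`); hence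
  **`klrk_jacobian_lipschitz_of_frameOK`**: for `B : BandBounds a b` with `4A < B.Dtmin` and admissible levels,
  `|𝒥_E(θ,ν) − 𝒥_E(θ,ν′)| ≤ (1/d² + π√2(2 + 4A)/d³)|ν − ν′|`, `d = B.Dtmin − 4A` — and the size twin `klrk_jacobian_le_of_frameOK` (`≤ π√2/d`).
So the insertion data of ZS-RECIPE §3 read, per unit local factor: `B_W = π√2/d`, `L_W = 1/d² + π√2(2+4A)/d³`, functions of `(R, U, c, B.Dtmin)` only.
Pure analysis on landed objects; nothing about the effective action is asserted.  0 kit.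
-/

noncomputable section

namespace Summit.HubbardSuperconductivity.HubbardSuperconductivity.Theorems.KLRegimeSplit

set_option linter.dupNamespace false -- summit = problem name (single-conjunct summit), D-0017

open Real Set Literature.MathematicalPhysics.QuantumLattice
open Literature.MathematicalPhysics.QuantumLattice.BandSectorCounting
open Summit.HubbardSuperconductivity.HubbardSuperconductivity.Theorems.PerturbedFermiCurve
open Summit.HubbardSuperconductivity.HubbardSuperconductivity.Theorems.DispersionFlow

/-! ## §1 Radial Lipschitz of a directional derivative from a second-derivative bound -/

/-- **Mean value along a ray**: for `δ ∈ C²(ℝ²)` (sup-norm `Fin 2 → ℝ`) with `‖D(Dδ)(k)‖ ≤ κ₂` for all `k` and a direction `‖v‖ ≤ 1`,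
the directional derivative `r ↦ Dδ(r·v)[v]` is `κ₂`-Lipschitz: `|Dδ(s·v)[v] − Dδ(t·v)[v]| ≤ κ₂·|s − t|`. -/
theorem klrk_radial_fderiv_lipschitz {δ : (Fin 2 → ℝ) → ℝ} (hδ2 : ContDiff ℝ 2 δ) {κ₂ : ℝ}
    (h2 : ∀ k : Fin 2 → ℝ, ‖fderiv ℝ (fderiv ℝ δ) k‖ ≤ κ₂) {v : Fin 2 → ℝ} (hv : ‖v‖ ≤ 1) (s t : ℝ) :
    |fderiv ℝ δ (s • v) v - fderiv ℝ δ (t • v) v| ≤ κ₂ * |s - t| := by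
  -- the function along the ray and its derivative
  set g : ℝ → ℝ := fun r => fderiv ℝ δ (r • v) v with hg
  have hdiff : Differentiable ℝ (fderiv ℝ δ) :=
    (hδ2.fderiv_right (m := 1) (by norm_num)).differentiable (by norm_num)
  have hderiv : ∀ r : ℝ, HasDerivAt g ((fderiv ℝ (fderiv ℝ δ) (r • v) v) v) r := by
    intro r
    have h1 : HasDerivAt (fun r : ℝ => r • v) v r := by
      simpa using (hasDerivAt_id r).smul_const v
    have h2' : HasFDerivAt (fderiv ℝ δ) (fderiv ℝ (fderiv ℝ δ) (r • v)) (r • v) := (hdiff _).hasFDerivAt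
    have h3 : HasDerivAt (fun r : ℝ => fderiv ℝ δ (r • v)) (fderiv ℝ (fderiv ℝ δ) (r • v) v) r :=
      h2'.comp_hasDerivAt r h1
    have h4 := h3.clm_apply (hasDerivAt_const r v)
    simpa using h4
  have hbound : ∀ r : ℝ, ‖(fderiv ℝ (fderiv ℝ δ) (r • v) v) v‖ ≤ κ₂ := by
    intro r
    calc ‖(fderiv ℝ (fderiv ℝ δ) (r • v) v) v‖ ≤ ‖fderiv ℝ (fderiv ℝ δ) (r • v) v‖ * ‖v‖ := ContinuousLinearMap.le_opNorm _ _
      _ ≤ ‖fderiv ℝ (fderiv ℝ δ) (r • v)‖ * ‖v‖ * ‖v‖ :=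
          mul_le_mul_of_nonneg_right (ContinuousLinearMap.le_opNorm _ _) (norm_nonneg _)
      _ ≤ κ₂ * 1 * 1 := by
          have hκ : 0 ≤ κ₂ := le_trans (norm_nonneg (fderiv ℝ (fderiv ℝ δ) 0)) (h2 0)
          have hv0 : 0 ≤ ‖v‖ := norm_nonneg _
          have := h2 (r • v)
          gcongr
      _ = κ₂ := by ring
  have hmv := Convex.norm_image_sub_le_of_norm_hasDerivWithin_le (f := g) (s := Set.univ)
    (fun r _ => (hderiv r).hasDerivWithinAt) (fun r _ => hbound r) convex_univ (Set.mem_univ t) (Set.mem_univ s)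
  rw [Real.norm_eq_abs, Real.norm_eq_abs] at hmv
  exact hmv

/-! ## §2 The frame instance under `FrameOK` in the KL regime -/

section Frame

variable {R : RenConsts} {U c β μ : ℝ} {K : TrigPolyC4v}

/-- The regime `C²` size of an admissible frame: `A = 2·Gfr 0·|U| + 2·Gfr 1·U² + Gfr 2·c/log 4`. -/
theorem klrk_frame_C2_bound (hR : ∀ j, 0 ≤ R.Gfr j) (hc : 0 ≤ c) (hβmin : klBetaMin ≤ β) (hβc : β ≤ Real.exp (c / U ^ 2))
    (hK : FrameOK R U (nScales β) μ K) :
    ∀ p : Momentum, ∀ j ≤ 2, ‖iteratedFDeriv ℝ j (frameShift K) p‖ ≤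
      2 * R.Gfr 0 * |U| + 2 * R.Gfr 1 * U ^ 2 + R.Gfr 2 * (c / Real.log 4) :=
  fun p _ hj => norm_iteratedFDeriv_frameShift_le_of_frameOK_regime hR hc hβmin hβc hK p hj

/-- **The radial Lipschitz input `κ₂ = 4A` for an admissible frame**: with `δ_K = frameShift K ∘ toLp`,
`|Dδ_K(s·dir θ)[dir θ] − Dδ_K(t·dir θ)[dir θ]| ≤ 4A·|s − t|` for all `θ, s, t`. -/
theorem klrk_frameShift_radial_lipschitz (hR : ∀ j, 0 ≤ R.Gfr j) (hc : 0 ≤ c) (hβmin : klBetaMin ≤ β) (hβc : β ≤ Real.exp (c / U ^ 2))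
    (hK : FrameOK R U (nScales β) μ K) (θ s t : ℝ) :
    |fderiv ℝ (fun k : Fin 2 → ℝ => frameShift K (WithLp.toLp 2 k)) (s • dir θ) (dir θ) -
        fderiv ℝ (fun k : Fin 2 → ℝ => frameShift K (WithLp.toLp 2 k)) (t • dir θ) (dir θ)| ≤
      4 * (2 * R.Gfr 0 * |U| + 2 * R.Gfr 1 * U ^ 2 + R.Gfr 2 * (c / Real.log 4)) * |s - t| :=
  klrk_radial_fderiv_lipschitz (contDiff_frameShift_toLp K)
    (frameShift_toLp_small (klrk_frame_C2_bound hR hc hβmin hβc hK) le_rfl).2.2 (norm_dir_le_one θ) s t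

variable {a b : ℝ} (B : BandBounds a b)

/-- **Size of the frame-curve Jacobian under `FrameOK`**: if `4A < B.Dtmin` then at every admissible level (`a ≤ ν − 4A`, `ν + 4A ≤ b`)
`0 ≤ 𝒥_E(θ,ν) ≤ π√2/(B.Dtmin − 4A)`. -/
theorem klrk_jacobian_le_of_frameOK (hR : ∀ j, 0 ≤ R.Gfr j) (hc : 0 ≤ c) (hβmin : klBetaMin ≤ β) (hβc : β ≤ Real.exp (c / U ^ 2))
    (hK : FrameOK R U (nScales β) μ K)
    (hA : 4 * (2 * R.Gfr 0 * |U| + 2 * R.Gfr 1 * U ^ 2 + R.Gfr 2 * (c / Real.log 4)) < B.Dtmin) {ν : ℝ}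
    (hν : a ≤ ν - 4 * (2 * R.Gfr 0 * |U| + 2 * R.Gfr 1 * U ^ 2 + R.Gfr 2 * (c / Real.log 4)))
    (hν' : ν + 4 * (2 * R.Gfr 0 * |U| + 2 * R.Gfr 1 * U ^ 2 + R.Gfr 2 * (c / Real.log 4)) ≤ b) (θ : ℝ) :
    0 ≤ perturbedFermiRadius (fun k : Fin 2 → ℝ => frameShift K (WithLp.toLp 2 k)) ν θ *
        (rayDispersionDt θ (perturbedFermiRadius (fun k : Fin 2 → ℝ => frameShift K (WithLp.toLp 2 k)) ν θ) +
          fderiv ℝ (fun k : Fin 2 → ℝ => frameShift K (WithLp.toLp 2 k))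
            (perturbedFermiRadius (fun k : Fin 2 → ℝ => frameShift K (WithLp.toLp 2 k)) ν θ • dir θ) (dir θ))⁻¹ ∧
    perturbedFermiRadius (fun k : Fin 2 → ℝ => frameShift K (WithLp.toLp 2 k)) ν θ *
        (rayDispersionDt θ (perturbedFermiRadius (fun k : Fin 2 → ℝ => frameShift K (WithLp.toLp 2 k)) ν θ) +
          fderiv ℝ (fun k : Fin 2 → ℝ => frameShift K (WithLp.toLp 2 k))
            (perturbedFermiRadius (fun k : Fin 2 → ℝ => frameShift K (WithLp.toLp 2 k)) ν θ • dir θ) (dir θ))⁻¹ ≤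
      Real.pi * Real.sqrt 2 / (B.Dtmin - 4 * (2 * R.Gfr 0 * |U| + 2 * R.Gfr 1 * U ^ 2 + R.Gfr 2 * (c / Real.log 4))) := by
  have hsm := frameShift_toLp_small (klrk_frame_C2_bound hR hc hβmin hβc hK) le_rfl
  have hδc := continuous_frameShift_toLp K
  exact ⟨klrj_jacobian_nonneg B (fun k _ => hsm.1 k) (fun k _ => hsm.2.1 k) hA hδc hν hν' θ,
    klrj_jacobian_le B (fun k _ => hsm.1 k) (fun k _ => hsm.2.1 k) hA hδc hν hν' θ⟩

/-- **e-Lipschitz constant of the frame-curve Jacobian under `FrameOK`** (`klrj_jacobian_lipschitz` with all four inputs discharged): with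
`A` as above, `4A < B.Dtmin`, `d = B.Dtmin − 4A`, for admissible levels `ν, ν′`:
`|𝒥_E(θ,ν) − 𝒥_E(θ,ν′)| ≤ (1/d² + π√2·(2 + 4A)/d³)·|ν − ν′|`. -/
theorem klrk_jacobian_lipschitz_of_frameOK (hR : ∀ j, 0 ≤ R.Gfr j) (hc : 0 ≤ c) (hβmin : klBetaMin ≤ β)
    (hβc : β ≤ Real.exp (c / U ^ 2)) (hK : FrameOK R U (nScales β) μ K)
    (hA : 4 * (2 * R.Gfr 0 * |U| + 2 * R.Gfr 1 * U ^ 2 + R.Gfr 2 * (c / Real.log 4)) < B.Dtmin) (θ : ℝ) {ν ν' : ℝ}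
    (hν : a ≤ ν - 4 * (2 * R.Gfr 0 * |U| + 2 * R.Gfr 1 * U ^ 2 + R.Gfr 2 * (c / Real.log 4)))
    (hνb : ν + 4 * (2 * R.Gfr 0 * |U| + 2 * R.Gfr 1 * U ^ 2 + R.Gfr 2 * (c / Real.log 4)) ≤ b)
    (hν'a : a ≤ ν' - 4 * (2 * R.Gfr 0 * |U| + 2 * R.Gfr 1 * U ^ 2 + R.Gfr 2 * (c / Real.log 4)))
    (hν' : ν' + 4 * (2 * R.Gfr 0 * |U| + 2 * R.Gfr 1 * U ^ 2 + R.Gfr 2 * (c / Real.log 4)) ≤ b) :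
    |perturbedFermiRadius (fun k : Fin 2 → ℝ => frameShift K (WithLp.toLp 2 k)) ν θ *
          (rayDispersionDt θ (perturbedFermiRadius (fun k : Fin 2 → ℝ => frameShift K (WithLp.toLp 2 k)) ν θ) +
            fderiv ℝ (fun k : Fin 2 → ℝ => frameShift K (WithLp.toLp 2 k))
              (perturbedFermiRadius (fun k : Fin 2 → ℝ => frameShift K (WithLp.toLp 2 k)) ν θ • dir θ) (dir θ))⁻¹ -
        perturbedFermiRadius (fun k : Fin 2 → ℝ => frameShift K (WithLp.toLp 2 k)) ν' θ *
          (rayDispersionDt θ (perturbedFermiRadius (fun k : Fin 2 → ℝ => frameShift K (WithLp.toLp 2 k)) ν' θ) +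
            fderiv ℝ (fun k : Fin 2 → ℝ => frameShift K (WithLp.toLp 2 k))
              (perturbedFermiRadius (fun k : Fin 2 → ℝ => frameShift K (WithLp.toLp 2 k)) ν' θ • dir θ) (dir θ))⁻¹| ≤
      (1 / (B.Dtmin - 4 * (2 * R.Gfr 0 * |U| + 2 * R.Gfr 1 * U ^ 2 + R.Gfr 2 * (c / Real.log 4))) ^ 2 +
          Real.pi * Real.sqrt 2 * (2 + 4 * (2 * R.Gfr 0 * |U| + 2 * R.Gfr 1 * U ^ 2 + R.Gfr 2 * (c / Real.log 4))) /
            (B.Dtmin - 4 * (2 * R.Gfr 0 * |U| + 2 * R.Gfr 1 * U ^ 2 + R.Gfr 2 * (c / Real.log 4))) ^ 3) *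
        |ν - ν'| := by
  have hAb := klrk_frame_C2_bound hR hc hβmin hβc hK
  have hsm := frameShift_toLp_small hAb le_rfl
  have hA0 : 0 ≤ 2 * R.Gfr 0 * |U| + 2 * R.Gfr 1 * U ^ 2 + R.Gfr 2 * (c / Real.log 4) :=
    (norm_nonneg _).trans (hAb 0 0 (by norm_num))
  exact klrj_jacobian_lipschitz B (contDiff_frameShift_toLp K) (fun k _ => hsm.1 k) (fun k _ => hsm.2.1 k) hA (by positivity)
    (fun s t _ _ => klrk_frameShift_radial_lipschitz hR hc hβmin hβc hK θ s t) hν hνb hν'a hν'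

end Frame

end Summit.HubbardSuperconductivity.HubbardSuperconductivity.Theorems.KLRegimeSplit

end
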